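import Mathlib
import Summits.Ventures.PercRepro2.CoinKSureLayer
import Summits.Ventures.PercRepro2.CoinKSureAD
import Summits.Ventures.PercRepro2.CoinKSureFibers
import Summits.Ventures.PercRepro2.CoinChainQstar

/-!
# The QUANTITATIVE clean-state theorem — the ideal base term kept — and the universal PURE chain
from the clean-state base bound
(blind cell PercRepro2, night-2 g23; proofs/NIGHT2-DARC.md §63.13)

The clean-state theorem `gate_functional_nonneg` (§49) splits the gate functional by the entry
states and proves the between-state sum `∑ G' (ΛX̄ − Λ₁)(ΛȲ − Λ₂) ≥ 0` by the clean state lemma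
`csl_main` — a layer cake of one state shift whose level sums are nonnegative by `level_holley`,
with the IDEAL state's term `w₀·∑ G'(ΛX̄ − Λ₁)` as the base.  The base term need not be dropped:
the layer cake of `w − w₀` gives the QUANTITATIVE bound

  `∑ G' (ΛX̄ − Λ₁)(ΛȲ − Λ₂) ≥ w₀ · ∑ G' (ΛX̄ − Λ₁)`,   `w₀ = Λ·Ȳ_∅ − Λ₂` (the ideal `y`-shift),

whatever the sign of the gate's `x`-excess.  Cleared by the ideal mass:
**`gate_functional_ge_baseY`**: `(Λ·Ny∅ − Λ₂·N∅)·(Λ·∑G'x − Λ₁·∑G') ≤ N∅·T(G, G')` (and the mirror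
`gate_functional_ge_baseX`).  For the pure AND-switch chain this is
`m·U111 ≥ (b0 yI − m b2)(b0 g1 − b1 g0)`, a lower bound on the world-1 functional by the product
of the ideal `y`-shift and the gate's `x`-excess — nontrivial exactly when the gate LOWERS the
`x`-mean (`A = g1 − p₁ g0 < 0`), the regime left open by `pureChain_functional_nonneg_of_pivotalX`.
THEOREM `pureChain_functional_nonneg_of_cslBaseY` / `_cslBaseX`: the pure chain at EVERY
`ρ ∈ [0, 1]` whenever `a0²·(b0 yI − m b2)(b0 g1 − b1 g0) + m·(b0 − g0)·Δ ≥ 0` (resp. the mirror).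
Exact census (n = 3, all pairs of up-set markers, the cell's tilt generator): together with the
three conditions of §63.3, §63.4, §63.10 these two cover EVERY one of the 26,184 anti-aligned
checks (work/py, 2026-08-28 00:1xZ).
-/

namespace Summit.Ventures.PercRepro2.Coin

open Classical

section CleanBase

variable {V : Type*} [DecidableEq V] {R : Type*} [Field R] [LinearOrder R] [IsStrictOrderedRing R]

set_option maxHeartbeats 400000 in
/-- **THE QUANTITATIVE CLEAN-STATE THEOREM (the `y`-layer cake with its base term).** With
`N∅ = ∑_{W ∩ ent = ∅} G' W`, `Ny∅ = ∑_{W ∩ ent = ∅} G' W y W` (the ideal state's gate mass and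
`y`-moment — equal to the `R`-law's by `hI`): `(Λ Ny∅ − Λ₂ N∅)·(Λ ∑G'x − Λ₁ ∑G') ≤ N∅·T(G, G')`. -/
theorem gate_functional_ge_baseY (U ent : Finset V) (G G' x y : Finset V → R)
    (hG : ∀ W, 0 ≤ G W) (hG' : ∀ W, 0 ≤ G' W)
    (hx0 : ∀ W, 0 ≤ x W) (hy0 : ∀ W, 0 ≤ y W)
    (hxm : ∀ s t, x s ≤ x (s ∪ t)) (hym : ∀ s t, y s ≤ y (s ∪ t))
    (wLL : ∀ s ⊆ U, ∀ t ⊆ U, G s * G t ≤ G (s ∩ t) * G (s ∪ t))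
    (wMM : ∀ s ⊆ U, ∀ t ⊆ U, G' s * G' t ≤ G' (s ∩ t) * G' (s ∪ t))
    (wML : ∀ s ⊆ U, ∀ t ⊆ U, (∃ r ∈ ent, r ∈ s) → G' s * G t ≤ G (s ∩ t) * G' (s ∪ t))
    (hI : ∀ W, W ∩ ent = ∅ → G' W = G W) :
    ((∑ W ∈ U.powerset, G W) * (∑ W ∈ U.powerset.filter (fun W => W ∩ ent = ∅), G' W * y W)
        - (∑ W ∈ U.powerset, G W * y W) * (∑ W ∈ U.powerset.filter (fun W => W ∩ ent = ∅), G' W)) *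
      ((∑ W ∈ U.powerset, G W) * (∑ W ∈ U.powerset, G' W * x W)
        - (∑ W ∈ U.powerset, G W * x W) * (∑ W ∈ U.powerset, G' W)) ≤
    (∑ W ∈ U.powerset.filter (fun W => W ∩ ent = ∅), G' W) *
      ((∑ W ∈ U.powerset, G W) ^ 2 * (∑ W ∈ U.powerset, G' W * (x W * y W))
        - (∑ W ∈ U.powerset, G W) * (∑ W ∈ U.powerset, G W * x W) *
          (∑ W ∈ U.powerset, G' W * y W)
        - (∑ W ∈ U.powerset, G W) * (∑ W ∈ U.powerset, G W * y W) *
          (∑ W ∈ U.powerset, G' W * x W)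
        + (∑ W ∈ U.powerset, G W * x W) * (∑ W ∈ U.powerset, G W * y W) *
          (∑ W ∈ U.powerset, G' W)) := by
  -- the `R`-law totals
  set Λ := ∑ W ∈ U.powerset, G W with hΛ
  set Λ₁ := ∑ W ∈ U.powerset, G W * x W with hΛ₁
  set Λ₂ := ∑ W ∈ U.powerset, G W * y W with hΛ₂
  have hΛ0 : 0 ≤ Λ := Finset.sum_nonneg fun W _ => hG W
  have hΛ₁0 : 0 ≤ Λ₁ := Finset.sum_nonneg fun W _ => mul_nonneg (hG W) (hx0 W)
  have hΛ₂0 : 0 ≤ Λ₂ := Finset.sum_nonneg fun W _ => mul_nonneg (hG W) (hy0 W)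
  clear_value Λ Λ₁ Λ₂
  -- state masses and state means of the gate
  set N : Finset V → R := fun e => ∑ W ∈ U.powerset.filter (fun W => W ∩ ent = e), G' W with hN
  set Nx : Finset V → R :=
    fun e => ∑ W ∈ U.powerset.filter (fun W => W ∩ ent = e), G' W * x W with hNx
  set Ny : Finset V → R :=
    fun e => ∑ W ∈ U.powerset.filter (fun W => W ∩ ent = e), G' W * y W with hNy
  have hN0 : ∀ e, 0 ≤ N e := fun e => Finset.sum_nonneg fun W _ => hG' W
  have hNx0 : ∀ e, 0 ≤ Nx e := fun e => Finset.sum_nonneg fun W _ => mul_nonneg (hG' W) (hx0 W)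
  have hNy0 : ∀ e, 0 ≤ Ny e := fun e => Finset.sum_nonneg fun W _ => mul_nonneg (hG' W) (hy0 W)
  set Xb : Finset V → R := fun W => Nx (W ∩ ent) / N (W ∩ ent) with hXb
  set Yb : Finset V → R := fun W => Ny (W ∩ ent) / N (W ∩ ent) with hYb
  have hXb0 : ∀ W, 0 ≤ Xb W := fun W => div_nonneg (hNx0 _) (hN0 _)
  have hYb0 : ∀ W, 0 ≤ Yb W := fun W => div_nonneg (hNy0 _) (hN0 _)
  -- the state mass of a cluster in the support is positive
  have hNpos : ∀ s ⊆ U, G' s ≠ 0 → 0 < N (s ∩ ent) := by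
    intro s hs hs0
    have h1 : 0 < G' s := lt_of_le_of_ne (hG' s) (Ne.symm hs0)
    have h2 : G' s ≤ N (s ∩ ent) :=
      Finset.single_le_sum (f := G') (fun W _ => hG' W)
        (Finset.mem_filter.mpr ⟨Finset.mem_powerset.mpr hs, rfl⟩)
    exact lt_of_lt_of_le h1 h2
  -- joins stay in the support
  have hjoin : ∀ s ⊆ U, ∀ t ⊆ U, G' s ≠ 0 → G' t ≠ 0 → G' (s ∪ t) ≠ 0 := by
    intro s hs t ht hs0 ht0 hu
    have h1 : 0 < G' s * G' t :=
      mul_pos (lt_of_le_of_ne (hG' s) (Ne.symm hs0)) (lt_of_le_of_ne (hG' t) (Ne.symm ht0))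
    have h2 := wMM s hs t ht
    rw [hu, mul_zero] at h2
    exact absurd (lt_of_lt_of_le h1 h2) (lt_irrefl 0)
  have hjoin' : ∀ s ⊆ U, ∀ t ⊆ U, (∃ r ∈ ent, r ∈ s) → G' s ≠ 0 → G t ≠ 0 →
      G' (s ∪ t) ≠ 0 := by
    intro s hs t ht hent hs0 ht0 hu
    have h1 : 0 < G' s * G t :=
      mul_pos (lt_of_le_of_ne (hG' s) (Ne.symm hs0)) (lt_of_le_of_ne (hG t) (Ne.symm ht0))
    have h2 := wML s hs t ht hent
    rw [hu, mul_zero] at h2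
    exact absurd (lt_of_lt_of_le h1 h2) (lt_irrefl 0)
  -- the state means are increasing on the support
  have hXb_mono : ∀ s ⊆ U, ∀ t ⊆ U, G' s ≠ 0 → G' (s ∪ t) ≠ 0 → Xb s ≤ Xb (s ∪ t) := by
    intro s hs t ht hs0 hu0
    have hee : s ∩ ent ⊆ (s ∪ t) ∩ ent :=
      Finset.inter_subset_inter Finset.subset_union_left (Finset.Subset.refl _)
    have hNs := hNpos s hs hs0
    have hNu := hNpos (s ∪ t) (Finset.union_subset hs ht) hu0
    have key : Nx (s ∩ ent) * N ((s ∪ t) ∩ ent) ≤ N (s ∩ ent) * Nx ((s ∪ t) ∩ ent) :=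
      fiber_holley U ent (s ∩ ent) ((s ∪ t) ∩ ent) G' x hG' hx0 hxm wMM hee
    show Nx (s ∩ ent) / N (s ∩ ent) ≤ Nx ((s ∪ t) ∩ ent) / N ((s ∪ t) ∩ ent)
    rw [div_le_div_iff₀ hNs hNu]
    linarith [key]
  have hYb_mono : ∀ s ⊆ U, ∀ t ⊆ U, G' s ≠ 0 → G' (s ∪ t) ≠ 0 → Yb s ≤ Yb (s ∪ t) := by
    intro s hs t ht hs0 hu0
    have hee : s ∩ ent ⊆ (s ∪ t) ∩ ent :=
      Finset.inter_subset_inter Finset.subset_union_left (Finset.Subset.refl _)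
    have hNs := hNpos s hs hs0
    have hNu := hNpos (s ∪ t) (Finset.union_subset hs ht) hu0
    have key : Ny (s ∩ ent) * N ((s ∪ t) ∩ ent) ≤ N (s ∩ ent) * Ny ((s ∪ t) ∩ ent) :=
      fiber_holley U ent (s ∩ ent) ((s ∪ t) ∩ ent) G' y hG' hy0 hym wMM hee
    show Ny (s ∩ ent) / N (s ∩ ent) ≤ Ny ((s ∪ t) ∩ ent) / N ((s ∪ t) ∩ ent)
    rw [div_le_div_iff₀ hNs hNu]
    linarith [key]
  -- the ideal state: gate = `R`-law there, and its means are below the global `R`-means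
  have hG'I : ∀ W ∈ U.powerset.filter (fun W => W ∩ ent = ∅), G' W = G W :=
    fun W hW => hI W (Finset.mem_filter.mp hW).2
  have hNI : N ∅ = ∑ W ∈ U.powerset.filter (fun W => W ∩ ent = ∅), G W :=
    Finset.sum_congr rfl fun W hW => hG'I W hW
  have hNxI : Nx ∅ = ∑ W ∈ U.powerset.filter (fun W => W ∩ ent = ∅), G W * x W :=
    Finset.sum_congr rfl fun W hW => by rw [hG'I W hW]
  have hNyI : Ny ∅ = ∑ W ∈ U.powerset.filter (fun W => W ∩ ent = ∅), G W * y W :=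
    Finset.sum_congr rfl fun W hW => by rw [hG'I W hW]
  have hu₀ : Λ * (Nx ∅ / N ∅) - Λ₁ ≤ 0 := by
    by_cases h : N ∅ = 0
    · rw [h, div_zero, mul_zero]; linarith
    · have hpos : 0 < N ∅ := lt_of_le_of_ne (hN0 ∅) (Ne.symm h)
      have key : Nx ∅ * Λ ≤ N ∅ * Λ₁ := by
        rw [hNxI, hNI, hΛ, hΛ₁]; exact ideal_mean U ent G x hG hx0 hxm wLL
      have : Λ * (Nx ∅ / N ∅) ≤ Λ₁ := by
        rw [mul_div_assoc', div_le_iff₀ hpos]; linarith [key]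
      linarith
  have hw₀ : Λ * (Ny ∅ / N ∅) - Λ₂ ≤ 0 := by
    by_cases h : N ∅ = 0
    · rw [h, div_zero, mul_zero]; linarith
    · have hpos : 0 < N ∅ := lt_of_le_of_ne (hN0 ∅) (Ne.symm h)
      have key : Ny ∅ * Λ ≤ N ∅ * Λ₂ := by
        rw [hNyI, hNI, hΛ, hΛ₂]; exact ideal_mean U ent G y hG hy0 hym wLL
      have : Λ * (Ny ∅ / N ∅) ≤ Λ₂ := by
        rw [mul_div_assoc', div_le_iff₀ hpos]; linarith [key]
      linarith
  -- every state mean on the support is above the ideal state mean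
  have hu : ∀ W ∈ U.powerset, G' W ≠ 0 → Λ * (Nx ∅ / N ∅) - Λ₁ ≤ Λ * Xb W - Λ₁ := by
    intro W hW hW0
    have hWU : W ⊆ U := Finset.mem_powerset.mp hW
    have hle : Nx ∅ / N ∅ ≤ Xb W := by
      by_cases h : N ∅ = 0
      · rw [h, div_zero]; exact hXb0 W
      · have hpos : 0 < N ∅ := lt_of_le_of_ne (hN0 ∅) (Ne.symm h)
        have hNW := hNpos W hWU hW0
        have key : Nx ∅ * N (W ∩ ent) ≤ N ∅ * Nx (W ∩ ent) :=
          fiber_holley U ent ∅ (W ∩ ent) G' x hG' hx0 hxm wMM (Finset.empty_subset _)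
        show Nx ∅ / N ∅ ≤ Nx (W ∩ ent) / N (W ∩ ent)
        rw [div_le_div_iff₀ hpos hNW]
        linarith [key]
    have := mul_le_mul_of_nonneg_left hle hΛ0
    linarith
  have hw : ∀ W ∈ U.powerset, G' W ≠ 0 → Λ * (Ny ∅ / N ∅) - Λ₂ ≤ Λ * Yb W - Λ₂ := by
    intro W hW hW0
    have hWU : W ⊆ U := Finset.mem_powerset.mp hW
    have hle : Ny ∅ / N ∅ ≤ Yb W := by
      by_cases h : N ∅ = 0
      · rw [h, div_zero]; exact hYb0 W
      · have hpos : 0 < N ∅ := lt_of_le_of_ne (hN0 ∅) (Ne.symm h)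
        have hNW := hNpos W hWU hW0
        have key : Ny ∅ * N (W ∩ ent) ≤ N ∅ * Ny (W ∩ ent) :=
          fiber_holley U ent ∅ (W ∩ ent) G' y hG' hy0 hym wMM (Finset.empty_subset _)
        show Ny ∅ / N ∅ ≤ Ny (W ∩ ent) / N (W ∩ ent)
        rw [div_le_div_iff₀ hpos hNW]
        linarith [key]
    have := mul_le_mul_of_nonneg_left hle hΛ0
    linarith
  -- the level sets of the `y`-shift: Holley-above the `R`-law
  have hlevw : ∀ t, Λ * (Ny ∅ / N ∅) - Λ₂ < t →
      0 ≤ ∑ W ∈ U.powerset.filter (fun W => t ≤ Λ * Yb W - Λ₂), G' W * (Λ * Xb W - Λ₁) := by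
    intro t ht
    have hP : ∀ s ⊆ U, ∀ t' ⊆ U, t ≤ Λ * Yb s - Λ₂ → G' s ≠ 0 → G t' ≠ 0 →
        t ≤ Λ * Yb (s ∪ t') - Λ₂ ∧ (∃ r ∈ ent, r ∈ s) := by
      intro s hs t' ht' hPs hs0 ht'0
      have hent : ∃ r ∈ ent, r ∈ s := by
        by_contra hno
        have hse : s ∩ ent = ∅ := by
          rw [Finset.eq_empty_iff_forall_notMem]
          intro r hr
          rw [Finset.mem_inter] at hr
          exact hno ⟨r, hr.2, hr.1⟩
        have hYs : Yb s = Ny ∅ / N ∅ := by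
          show Ny (s ∩ ent) / N (s ∩ ent) = Ny ∅ / N ∅
          rw [hse]
        rw [hYs] at hPs
        linarith
      refine ⟨?_, hent⟩
      have hu0 := hjoin' s hs t' ht' hent hs0 ht'0
      have hmono := hYb_mono s hs t' ht' hs0 hu0
      have := mul_le_mul_of_nonneg_left hmono hΛ0
      linarith
    have key := level_holley U ent G G' x hG hG' hx0 hxm wML (fun W => t ≤ Λ * Yb W - Λ₂) hP
    rw [← hΛ, ← hΛ₁] at key
    have hmean : (∑ W ∈ U.powerset.filter (fun W => t ≤ Λ * Yb W - Λ₂), G' W * Xb W) =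
        ∑ W ∈ U.powerset.filter (fun W => t ≤ Λ * Yb W - Λ₂), G' W * x W :=
      sum_fiber_mean U ent G' x hG' (fun e => t ≤ Λ * (Ny e / N e) - Λ₂)
    have hexp : (∑ W ∈ U.powerset.filter (fun W => t ≤ Λ * Yb W - Λ₂), G' W * (Λ * Xb W - Λ₁)) =
        Λ * (∑ W ∈ U.powerset.filter (fun W => t ≤ Λ * Yb W - Λ₂), G' W * Xb W) -
          Λ₁ * (∑ W ∈ U.powerset.filter (fun W => t ≤ Λ * Yb W - Λ₂), G' W) := by
      rw [Finset.mul_sum, Finset.mul_sum, ← Finset.sum_sub_distrib]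
      exact Finset.sum_congr rfl fun W _ => by ring
    rw [hexp, hmean]
    linarith [key]
  -- the level sets of the `x`-shift: Holley-above the `R`-law
  have hlevu : ∀ t, Λ * (Nx ∅ / N ∅) - Λ₁ < t →
      0 ≤ ∑ W ∈ U.powerset.filter (fun W => t ≤ Λ * Xb W - Λ₁), G' W * (Λ * Yb W - Λ₂) := by
    intro t ht
    have hP : ∀ s ⊆ U, ∀ t' ⊆ U, t ≤ Λ * Xb s - Λ₁ → G' s ≠ 0 → G t' ≠ 0 →
        t ≤ Λ * Xb (s ∪ t') - Λ₁ ∧ (∃ r ∈ ent, r ∈ s) := by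
      intro s hs t' ht' hPs hs0 ht'0
      have hent : ∃ r ∈ ent, r ∈ s := by
        by_contra hno
        have hse : s ∩ ent = ∅ := by
          rw [Finset.eq_empty_iff_forall_notMem]
          intro r hr
          rw [Finset.mem_inter] at hr
          exact hno ⟨r, hr.2, hr.1⟩
        have hXs : Xb s = Nx ∅ / N ∅ := by
          show Nx (s ∩ ent) / N (s ∩ ent) = Nx ∅ / N ∅
          rw [hse]
        rw [hXs] at hPs
        linarith
      refine ⟨?_, hent⟩
      have hu0 := hjoin' s hs t' ht' hent hs0 ht'0
      have hmono := hXb_mono s hs t' ht' hs0 hu0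
      have := mul_le_mul_of_nonneg_left hmono hΛ0
      linarith
    have key := level_holley U ent G G' y hG hG' hy0 hym wML (fun W => t ≤ Λ * Xb W - Λ₁) hP
    rw [← hΛ, ← hΛ₂] at key
    have hmean : (∑ W ∈ U.powerset.filter (fun W => t ≤ Λ * Xb W - Λ₁), G' W * Yb W) =
        ∑ W ∈ U.powerset.filter (fun W => t ≤ Λ * Xb W - Λ₁), G' W * y W :=
      sum_fiber_mean U ent G' y hG' (fun e => t ≤ Λ * (Nx e / N e) - Λ₁)
    have hexp : (∑ W ∈ U.powerset.filter (fun W => t ≤ Λ * Xb W - Λ₁), G' W * (Λ * Yb W - Λ₂)) =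
        Λ * (∑ W ∈ U.powerset.filter (fun W => t ≤ Λ * Xb W - Λ₁), G' W * Yb W) -
          Λ₂ * (∑ W ∈ U.powerset.filter (fun W => t ≤ Λ * Xb W - Λ₁), G' W) := by
      rw [Finset.mul_sum, Finset.mul_sum, ← Finset.sum_sub_distrib]
      exact Finset.sum_congr rfl fun W _ => by ring
    rw [hexp, hmean]
    linarith [key]
  -- FKG for the gate with the increasing state means
  have hF : (∑ W ∈ U.powerset, G' W * Xb W) * (∑ W ∈ U.powerset, G' W * Yb W) ≤
      (∑ W ∈ U.powerset, G' W) * (∑ W ∈ U.powerset, G' W * (Xb W * Yb W)) := by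
    have n₁ : ∀ W, 0 ≤ G' W * Xb W := fun W => mul_nonneg (hG' W) (hXb0 W)
    have n₂ : ∀ W, 0 ≤ G' W * Yb W := fun W => mul_nonneg (hG' W) (hYb0 W)
    have n₃ : ∀ W, 0 ≤ G' W := hG'
    have n₄ : ∀ W, 0 ≤ G' W * (Xb W * Yb W) :=
      fun W => mul_nonneg (hG' W) (mul_nonneg (hXb0 W) (hYb0 W))
    refine ad_pointwise U _ _ _ _ n₁ n₂ n₃ n₄ ?_
    intro s hs t ht
    by_cases hs0 : G' s = 0
    · rw [hs0, zero_mul, zero_mul]; exact mul_nonneg (n₃ _) (n₄ _)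
    · by_cases ht0 : G' t = 0
      · rw [ht0, zero_mul, mul_zero]; exact mul_nonneg (n₃ _) (n₄ _)
      · have hu0 := hjoin s hs t ht hs0 ht0
        have hxs := hXb_mono s hs t ht hs0 hu0
        have hu0' : G' (t ∪ s) ≠ 0 := by rw [Finset.union_comm]; exact hu0
        have hyt : Yb t ≤ Yb (s ∪ t) := by
          rw [Finset.union_comm]; exact hYb_mono t ht s hs ht0 hu0'
        calc G' s * Xb s * (G' t * Yb t) = (G' s * G' t) * (Xb s * Yb t) := by ring
          _ ≤ (G' (s ∩ t) * G' (s ∪ t)) * (Xb (s ∪ t) * Yb (s ∪ t)) :=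
              mul_le_mul (wMM s hs t ht) (mul_le_mul hxs hyt (hYb0 t) (hXb0 _))
                (mul_nonneg (hXb0 s) (hYb0 t)) (mul_nonneg (hG' _) (hG' _))
          _ = G' (s ∩ t) * (G' (s ∪ t) * (Xb (s ∪ t) * Yb (s ∪ t))) := by ring
  have e1 : (∑ W ∈ U.powerset, G' W * (Λ * Xb W - Λ₁)) =
      Λ * (∑ W ∈ U.powerset, G' W * Xb W) - Λ₁ * (∑ W ∈ U.powerset, G' W) := by
    rw [Finset.mul_sum, Finset.mul_sum, ← Finset.sum_sub_distrib]
    exact Finset.sum_congr rfl fun W _ => by ring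
  have e2 : (∑ W ∈ U.powerset, G' W * (Λ * Yb W - Λ₂)) =
      Λ * (∑ W ∈ U.powerset, G' W * Yb W) - Λ₂ * (∑ W ∈ U.powerset, G' W) := by
    rw [Finset.mul_sum, Finset.mul_sum, ← Finset.sum_sub_distrib]
    exact Finset.sum_congr rfl fun W _ => by ring
  have e3 : (∑ W ∈ U.powerset, G' W * (Λ * Xb W - Λ₁) * (Λ * Yb W - Λ₂)) =
      Λ * Λ * (∑ W ∈ U.powerset, G' W * (Xb W * Yb W))
        - Λ * Λ₂ * (∑ W ∈ U.powerset, G' W * Xb W)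
        - Λ * Λ₁ * (∑ W ∈ U.powerset, G' W * Yb W)
        + Λ₁ * Λ₂ * (∑ W ∈ U.powerset, G' W) := by
    rw [Finset.mul_sum, Finset.mul_sum, Finset.mul_sum, Finset.mul_sum,
      ← Finset.sum_sub_distrib, ← Finset.sum_sub_distrib, ← Finset.sum_add_distrib]
    exact Finset.sum_congr rfl fun W _ => by ring
  have hfkg : (∑ W ∈ U.powerset, G' W * (Λ * Xb W - Λ₁)) *
      (∑ W ∈ U.powerset, G' W * (Λ * Yb W - Λ₂)) ≤
      (∑ W ∈ U.powerset, G' W) *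
        ∑ W ∈ U.powerset, G' W * (Λ * Xb W - Λ₁) * (Λ * Yb W - Λ₂) := by
    rw [e1, e2, e3]
    have key := mul_le_mul_of_nonneg_left hF (mul_nonneg hΛ0 hΛ0)
    linarith [key]
  -- the quantitative layer cake of the `y`-shift with the ideal base term
  have hT2 : (Λ * (Ny ∅ / N ∅) - Λ₂) * (∑ W ∈ U.powerset, G' W * (Λ * Xb W - Λ₁)) ≤
      ∑ W ∈ U.powerset, G' W * (Λ * Xb W - Λ₁) * (Λ * Yb W - Λ₂) := by
    have hshift := sum_mul_nonneg_of_levels U.powerset (fun W => G' W * (Λ * Xb W - Λ₁))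
      (fun W => (Λ * Yb W - Λ₂) - (Λ * (Ny ∅ / N ∅) - Λ₂)) 0
      (fun W hW hc => by
        have hW0 : G' W ≠ 0 := fun h => hc (by rw [h, zero_mul])
        have := hw W hW hW0; linarith)
      (by rw [zero_mul])
      (fun t ht => by
        have e : U.powerset.filter (fun W => t ≤ (Λ * Yb W - Λ₂) - (Λ * (Ny ∅ / N ∅) - Λ₂)) =
            U.powerset.filter (fun W => t + (Λ * (Ny ∅ / N ∅) - Λ₂) ≤ Λ * Yb W - Λ₂) := by
          apply Finset.filter_congr; intro W _; constructor <;> intro h <;> linarith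
        rw [e]; exact hlevw _ (by linarith))
    have e : (∑ W ∈ U.powerset, G' W * (Λ * Xb W - Λ₁) * ((Λ * Yb W - Λ₂) - (Λ * (Ny ∅ / N ∅) - Λ₂)))
        = (∑ W ∈ U.powerset, G' W * (Λ * Xb W - Λ₁) * (Λ * Yb W - Λ₂))
          - (Λ * (Ny ∅ / N ∅) - Λ₂) * (∑ W ∈ U.powerset, G' W * (Λ * Xb W - Λ₁)) := by
      rw [Finset.mul_sum, ← Finset.sum_sub_distrib]
      exact Finset.sum_congr rfl fun W _ => by ring
    linarith [hshift, e]
  -- within-state FKG and the fibre identities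
  have hprod : (∑ W ∈ U.powerset, G' W * (Xb W * Yb W)) ≤
      ∑ W ∈ U.powerset, G' W * (x W * y W) :=
    sum_fiber_prod_le U ent G' x y hG' hx0 hy0 hxm hym wMM
  have hmx : (∑ W ∈ U.powerset, G' W * Xb W) = ∑ W ∈ U.powerset, G' W * x W :=
    sum_mean_eq U ent G' x hG'
  have hmy : (∑ W ∈ U.powerset, G' W * Yb W) = ∑ W ∈ U.powerset, G' W * y W :=
    sum_mean_eq U ent G' y hG'
  rw [e3, e1, hmx, hmy] at hT2
  have hprod' := mul_le_mul_of_nonneg_left hprod (mul_nonneg hΛ0 hΛ0)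
  -- clear the ideal mass
  by_cases hN : N ∅ = 0
  · -- the ideal state is empty: every ideal moment vanishes
    have hzero : ∀ W ∈ U.powerset.filter (fun W => W ∩ ent = ∅), G' W = 0 :=
      (Finset.sum_eq_zero_iff_of_nonneg (fun W _ => hG' W)).1 hN
    have hNy : Ny ∅ = 0 := Finset.sum_eq_zero fun W hW => by rw [hzero W hW, zero_mul]
    have hN' : (∑ W ∈ U.powerset.filter (fun W => W ∩ ent = ∅), G' W) = 0 := hN
    have hNy' : (∑ W ∈ U.powerset.filter (fun W => W ∩ ent = ∅), G' W * y W) = 0 := hNy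
    rw [hN', hNy']
    simp
  · have hNpos' : 0 < N ∅ := lt_of_le_of_ne (hN0 ∅) (Ne.symm hN)
    have hT2' := mul_le_mul_of_nonneg_left hT2 hNpos'.le
    have hdiv : N ∅ * (Λ * (Ny ∅ / N ∅) - Λ₂) = Λ * Ny ∅ - Λ₂ * N ∅ := by
      field_simp
    have hprod'' := mul_le_mul_of_nonneg_left hprod' hNpos'.le
    have hsq : Λ ^ 2 = Λ * Λ := sq Λ
    show (Λ * Ny ∅ - Λ₂ * N ∅) * (Λ * (∑ W ∈ U.powerset, G' W * x W) - Λ₁ * (∑ W ∈ U.powerset, G' W)) ≤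
      N ∅ * (Λ ^ 2 * (∑ W ∈ U.powerset, G' W * (x W * y W)) - Λ * Λ₁ * (∑ W ∈ U.powerset, G' W * y W)
        - Λ * Λ₂ * (∑ W ∈ U.powerset, G' W * x W) + Λ₁ * Λ₂ * (∑ W ∈ U.powerset, G' W))
    rw [hsq]
    have hL : (Λ * Ny ∅ - Λ₂ * N ∅) * (Λ * (∑ W ∈ U.powerset, G' W * x W) - Λ₁ * (∑ W ∈ U.powerset, G' W))
        = N ∅ * ((Λ * (Ny ∅ / N ∅) - Λ₂) * (Λ * (∑ W ∈ U.powerset, G' W * x W) - Λ₁ * (∑ W ∈ U.powerset, G' W))) := by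
      rw [← hdiv]; ring
    rw [hL]
    have h3 : N ∅ * (Λ * Λ * (∑ W ∈ U.powerset, G' W * (Xb W * Yb W)) - Λ * Λ₂ * (∑ W ∈ U.powerset, G' W * x W)
          - Λ * Λ₁ * (∑ W ∈ U.powerset, G' W * y W) + Λ₁ * Λ₂ * (∑ W ∈ U.powerset, G' W)) ≤
        N ∅ * (Λ * Λ * (∑ W ∈ U.powerset, G' W * (x W * y W)) - Λ * Λ₁ * (∑ W ∈ U.powerset, G' W * y W)
          - Λ * Λ₂ * (∑ W ∈ U.powerset, G' W * x W) + Λ₁ * Λ₂ * (∑ W ∈ U.powerset, G' W)) := by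
      have e4 : N ∅ * (Λ * Λ * (∑ W ∈ U.powerset, G' W * (x W * y W)) - Λ * Λ₁ * (∑ W ∈ U.powerset, G' W * y W)
          - Λ * Λ₂ * (∑ W ∈ U.powerset, G' W * x W) + Λ₁ * Λ₂ * (∑ W ∈ U.powerset, G' W))
          - N ∅ * (Λ * Λ * (∑ W ∈ U.powerset, G' W * (Xb W * Yb W)) - Λ * Λ₂ * (∑ W ∈ U.powerset, G' W * x W)
          - Λ * Λ₁ * (∑ W ∈ U.powerset, G' W * y W) + Λ₁ * Λ₂ * (∑ W ∈ U.powerset, G' W))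
          = N ∅ * (Λ * Λ * (∑ W ∈ U.powerset, G' W * (x W * y W))) - N ∅ * (Λ * Λ * (∑ W ∈ U.powerset, G' W * (Xb W * Yb W))) := by ring
      linarith [e4, hprod'']
    exact le_trans hT2' h3

end CleanBase

end Summit.Ventures.PercRepro2.Coin
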